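import Summits.ABC.StewartYu.PadicG3ScheduleG
import HarnessLib

/-!
# Cell abc-stewartyu, crux `Y07Odd` (stmt-ABC-19658), line `gen3-slab-odd`: the END SIZING of the v2 schedule in the frame's currency
# (the structural half of the registered stub `stub_endRecordG`)

`Summits/ABC/StewartYu/PadicG3EndG.lean` — cell `abc-stewartyu` (seat p2-g4, F-odd lead).  One definition (`XfinO`, the END range of the
odd frame = `⌊NG ŜG n/(2(n+1))⌋`, even points only) and theorems; no named fact.  With lp-1's END data `(D₀G, S₀NG, DG)`:
`2(n+1)·XfinO ≤ NG ŜG n`, `(n+1)·S₀NG < TordG ŜG n` (from `(K1G)` and the reserved floor `MG/(n+2)³ ≤ MordG`), `L₀G ≤ D₀G`,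
`2·Lb sideG ŜG j ≤ DG j` (`Nq ≥ 1`).  So `stub_endRecordG` reduces to `RecordOdd (256^·) p n V Vmax W D₀G S₀NG XfinO DG` (lp-1).

References: Yu. V. Nesterenko, LNM 1819 (2003) §5, (5.4); cell pages HOME/p1/K-M3.2-m0-branch.md.
-/

noncomputable section

open Finset
open Literature.NumberTheory.Transcendental

namespace Summit.ABC.StewartYu

namespace G3Setup

variable {p : ℕ} [Fact p.Prime] (S : G3Setup p) (P : PadicG3Par S.n)

/-- The END range of the odd frame: `⌊NG ŜG n / (2(n+1))⌋`. [cite: Nesterenko2003, (5.4); shape only] -/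
def XfinO : ℕ := S.NG P P.SdG S.n / (2 * (S.n + 1))

/-- `2(n+1)·XfinO ≤ NG ŜG n`. [folklore] -/
theorem two_mul_XfinO_le : 2 * ((S.n + 1) * S.XfinO P) ≤ S.NG P P.SdG S.n := by
  unfold XfinO
  rw [← mul_assoc]
  rw [mul_comm]
  exact Nat.div_mul_le_self _ _

/-- `remG ŜG n = 0`, so `TordG ŜG n = MordG ŜG n`. [folklore] -/
theorem TordG_last : S.TordG P P.SdG S.n = P.MordG P.SdG S.n := by
  unfold TordG remG; simp

/-- **`(n+1)·S₀NG < TordG ŜG n`.** [cite: Nesterenko2003, (4.5), §5.2; shape only] -/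
theorem succ_mul_S0NG_lt : (S.n + 1) * P.S0NG < S.TordG P P.SdG S.n := by
  rw [S.TordG_last]
  have hfloor := P.MG_div_le_MordG P.SdG S.n
  have hK := P.K1G
  have hn := P.hn
  -- `q = S0NG = MG/(n+2)⁴ ≥ 1` and `(n+2) q ≤ MG/(n+2)³`
  have hq1 : 1 ≤ P.S0NG := by
    have : 2 * S.n * (S.n + 1) * (P.Lg / 2 ^ (S.n + 22) + 1) ≥ 2 := by
      have h1 : 1 ≤ P.Lg / 2 ^ (S.n + 22) + 1 := Nat.le_add_left 1 _
      calc 2 = 2 * 1 * 1 * 1 := by ring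
        _ ≤ 2 * S.n * (S.n + 1) * (P.Lg / 2 ^ (S.n + 22) + 1) := by (gcongr; omega)
    generalize 2 * S.n * (S.n + 1) * (P.Lg / 2 ^ (S.n + 22) + 1) = e at this hK
    omega
  have hmul : (S.n + 2) * P.S0NG ≤ P.MG / (S.n + 2) ^ 3 := by
    unfold PadicG3Par.S0NG
    have : P.MG / (S.n + 2) ^ 4 = P.MG / (S.n + 2) ^ 3 / (S.n + 2) := by
      rw [Nat.div_div_eq_div_mul, ← pow_succ]
    rw [this, mul_comm]
    exact Nat.div_mul_le_self _ _
  calc (S.n + 1) * P.S0NG < (S.n + 2) * P.S0NG := by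
        exact Nat.mul_lt_mul_of_pos_right (by omega) (by omega)
    _ ≤ P.MordG P.SdG S.n := hmul.trans hfloor

/-- `L₀G ≤ D₀G`. [folklore] -/
theorem L0G_le_D0G : P.L0G ≤ P.D0G := by unfold PadicG3Par.D0G; omega

/-- `Lb s lev j ≤ 2 sⱼ / 2^{lev}` (real). [folklore] -/
theorem Lb_le_real (s : Fin S.n → ℕ) (lev : ℕ) (j : Fin S.n) : (S.Lb s lev j : ℝ) ≤ 2 * (s j : ℝ) / (2 : ℝ) ^ lev := by
  induction lev with
  | zero => simp [Lb]
  | succ lev ih =>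
      have h1 : (S.Lb s (lev + 1) j : ℝ) ≤ (S.Lb s lev j : ℝ) / 2 := by
        have : S.Lb s (lev + 1) j = S.Lb s lev j / 2 := rfl
        rw [this, le_div_iff₀ (by norm_num : (0 : ℝ) < 2)]
        exact_mod_cast Nat.div_mul_le_self _ _
      refine h1.trans ?_
      rw [pow_succ, div_le_iff₀ (by norm_num : (0 : ℝ) < 2)]
      have h2 : (0 : ℝ) < (2 : ℝ) ^ lev := by positivity
      calc (S.Lb s lev j : ℝ) ≤ 2 * (s j : ℝ) / (2 : ℝ) ^ lev := ih
        _ = 2 * (s j : ℝ) / ((2 : ℝ) ^ lev * 2) * 2 := by field_simp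

/-- **`2·Lb sideG ŜG j ≤ DG j`** (`sideG j = ⌊LG/(4Aⱼ)⌋`, `DG j = ⌊Nq·LG/(2^ŜG Aⱼ)⌋ + 1`, `Nq ≥ 1`). [cite: Nesterenko2003, §5.2; shape only] -/
theorem two_mul_Lb_le_DG (j : Fin S.n) : 2 * S.Lb (S.sideG P) P.SdG j ≤ P.DG j := by
  have hA := P.A_pos j
  have h2S : (0 : ℝ) < (2 : ℝ) ^ P.SdG := by positivity
  -- real bound `2·Lb ≤ LG/(2^ŜG Aⱼ) ≤ Nq·LG/(2^ŜG Aⱼ)`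
  have hside : (S.sideG P j : ℝ) ≤ (P.LG : ℝ) / (4 * P.A j) := by
    unfold sideG; exact Nat.floor_le (by positivity)
  have hLb := S.Lb_le_real (S.sideG P) P.SdG j
  have hreal : (2 * S.Lb (S.sideG P) P.SdG j : ℝ) ≤ (P.Nq : ℝ) * P.LG / ((2 : ℝ) ^ P.SdG * P.A j) := by
    have hNq : (1 : ℝ) ≤ P.Nq := by exact_mod_cast P.hNq
    calc (2 * S.Lb (S.sideG P) P.SdG j : ℝ) ≤ 2 * (2 * (S.sideG P j : ℝ) / (2 : ℝ) ^ P.SdG) := by linarith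
      _ ≤ 2 * (2 * ((P.LG : ℝ) / (4 * P.A j)) / (2 : ℝ) ^ P.SdG) := by gcongr
      _ = 1 * P.LG / ((2 : ℝ) ^ P.SdG * P.A j) := by field_simp; ring
      _ ≤ (P.Nq : ℝ) * P.LG / ((2 : ℝ) ^ P.SdG * P.A j) := by gcongr
  unfold PadicG3Par.DG
  have : 2 * S.Lb (S.sideG P) P.SdG j ≤ ⌊(P.Nq : ℝ) * P.LG / (2 ^ P.SdG * P.A j)⌋₊ := Nat.le_floor (by exact_mod_cast hreal)
  omega

/-- **The END sizing, packaged** (the structural half of `stub_endRecordG`). [cite: Nesterenko2003, §5; shape only] -/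
theorem endSizingG : 2 * ((S.n + 1) * S.XfinO P) ≤ S.NG P P.SdG S.n ∧ (S.n + 1) * P.S0NG < S.TordG P P.SdG S.n ∧ P.L0G ≤ P.D0G ∧
    ∀ j, 2 * S.Lb (S.sideG P) P.SdG j ≤ P.DG j :=
  ⟨S.two_mul_XfinO_le P, S.succ_mul_S0NG_lt P, L0G_le_D0G (S := S) P, S.two_mul_Lb_le_DG P⟩

end G3Setup

end Summit.ABC.StewartYu

end
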